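import Literature.IUT.HodgeTheaters.PiAvatarToFlStar
import Literature.IUT.HodgeTheaters.PiAvatarFlStarInvolutions
import Literature.IUT.HodgeTheaters.PiAvatarNegCompatGood
import Literature.IUT.HodgeTheaters.PuncturedEllipticCoveringsCusps

/-!
# [IUTchI] Ex 6.3 (ii), negative case, at the GENUINE initial Θ-data (good places): the global automorphism of the
# `[−1]`-square lies in `Aut_±(𝒟^{⊚±})` and is induced by an element of `Π_{C̲_K} ∖ Π_{X̲_K}` (proof-only; β-engine (I1)+(I2)(i))

S. Mochizuki, *Inter-universal Teichmüller theory I*, kurims manuscript (May 2020), Example 6.3 (ii) p. 161 ("one verifies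
immediately that `φ^{Θell}_±` is equivariant with respect to these poly-actions of `𝔽_l^{⋊±}`", NEGATIVE case), Def 6.1 (v)
p. 158 ("`Aut(𝒟^{⊚±}) ↠ 𝔽_l^⋇` … kernel `Aut_±(𝒟^{⊚±})`"; "`Aut_± … contains the subgroup Aut_K(X̲_K)`")
([IUTchI] Ex 6.3 (ii) p.161) [claim: Mochizuki2012, status: disputed] (D-0012 claim key, series status DISPUTED; nothing of the
series is asserted; no side is taken on [IUTchIII] Cor. 3.12).

β-ENGINE at the genuine data (abc-iut-L5-t13; reductions p420660/p423891: the law (β) `Ex63.NegCompatModel` of the genuine kit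
follows from, per place, an automorphism `a` of `𝒟_v̲`, an automorphism `b ∈ Aut_±(𝒟^{⊚±})` FIXING the zero-cusp class and MOVING
some class, and the square `a ≫ φ^{Θell}_{•,v̲} = φ^{Θell}_{•,v̲} ≫ b`).  Over abc-iut-L5-t4's binding (p423760 `phiEllAt`,
`gModelObj`, `locModelObj`; p425994 `toFlStarGlobal`) this PROOF-ONLY file records, at every GOOD place `v̲` (decomposition group
`Gv`) and conditional only on abc-iut-L5-t1's typed §1 claims `hA : ArrowCoveringClaims`:

* `InitialThetaData.toFlStarGlobal_autOfNormalizer_eq_one_of_mem_PiCund` — (I2)(i): for EVERY `c ∈ Π_{C̲_K}` the automorphism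
  `xΠ_{X̲_K} ↦ xcΠ_{X̲_K}` of `𝒟^{⊚±}` has `toFlStarGlobal = 1`, i.e. lies in `Aut_±(𝒟^{⊚±})` (my p425312: an element of the
  index-two overgroup `Π_{C̲_K} ⊇ Π_{X̲_K}` has exponent `±1` on `Π_{X_K}/Π_{X̲_K}` — NO law on how `ι` acts is used);
* `InitialThetaData.exists_negCompat_good_mem` — abc-iut-L5-t4's `exists_negCompat_good` (p422024) SHARPENED to export the
  element: `∃ c ∈ Π_{C̲_K} ∖ Π_{X̲_K}` normalising `Π_v̲` with the square ON THE NOSE and `toFlStarGlobal (aut c) = 1` — so the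
  only input of (β) still owed at good places is the LABEL reading «`c` fixes the zero cusp `ε⁰` and moves `ε′`» (abc-iut-L5-t1
  `CuspGalois.act_ε0` / `act_ε1`, through the binding's label slots (K1)/(K2));
* `InitialThetaData.exists_negCompat_good_cusp` — the same element `c = embK c′` read on abc-iut-L5-t1's cusp interface
  `CuspGalois` (p424023): `c′ ∈ Π_{C̲} ∖ Π_X` (the involution `ι̲` of `X̲_K` over `C̲_K`), so for EVERY cusp action datum `CG`,
  `CG.act c′` FIXES the zero cusp `ε⁰` (`act_ε0`) and carries `ε′ ↦ ε″ ≠ ε′` (`act_ε1`, `ε1_ne_ε2`) — the label inputs (I2)(ii) of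
  the β-engine, pinned to the SAME element as the square and the `Aut_±`-membership.  With the binding's label slots under (K1)/(K2)
  (`gLabMap (aut c) = CG.act c′` on `GLab 𝒟^{⊚±} ≃ Cusp`, `gChart₀ ε⁰ = 0`) this is literally the hypothesis list of
  `Ex63.negCompatModel_of_fixes` (p423891) at every good place.

Proof-only (no definitions); typed ≠ proved elsewhere.
-/

namespace Literature.IUT.HodgeTheaters

open CategoryTheory

universe u v w

section Genuine

variable {F : Type u} {K : Type v} {Fbar : Type w} [Field F] [NumberField F] [Field K]
  [NumberField K] [Algebra F K] [Field Fbar] [Algebra F Fbar] [Algebra K Fbar]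
  {E : WeierstrassCurve F} [E.IsElliptic] {l : ℕ} {P : BadPlacePredicates K}
  (D : InitialThetaData F K Fbar E l P)

namespace InitialThetaData

/-- **(I2)(i) at the genuine `𝒟^{⊚±}`: every element of `Π_{C̲_K}` acts on `𝒟^{⊚±} = ℬ(X̲_K)⁰` INSIDE `Aut_±(𝒟^{⊚±})`** — the
kit slot `toFlStarGlobal` (abc-iut-L5-t4 p425994) is trivial on the automorphism `xΠ_{X̲_K} ↦ xcΠ_{X̲_K}` for `c ∈ Π_{C̲_K}`
([IUTchI] Def 6.1 (v) p.158 "`Aut_±(𝒟^{⊚±}) … contains the subgroup Aut_K(X̲_K)`", at the deck involution of `𝒟^{⊚±} → 𝒟^⊚`);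
by `toFlStarOfNormalizer_eq_one_of_mem_of_relIndex_two` (p425312) with `[Π_{C̲_K} : Π_{X̲_K}] = 2` (abc-iut-L5-t4
`piXund_relIndex_piCund`). ([IUTchI] Def 6.1 (v) p.158) [claim: Mochizuki2012, status: disputed] -/
theorem toFlStarGlobal_autOfNormalizer_eq_one_of_mem_PiCund [Fact l.Prime] [(D.PiXund.subgroupOf D.PiXK).Normal]
    {c : D.PiC} (hc : c ∈ D.PiCund)
    (hcn : c ∈ Subgroup.normalizer ((D.PiXund : Subgroup D.PiC) : Set D.PiC)) :
    D.toFlStarGlobal (OrbitCat.autOfNormalizer c hcn) = 1 := by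
  rw [D.toFlStarGlobal_autOfNormalizer c hcn, inv_eq_one]
  exact toFlStarOfNormalizer_eq_one_of_mem_of_relIndex_two D.PiXund_le_PiXK D.PiXund_relIndex_PiXK
    D.piXund_relIndex_piCund (D.normalizerIncl ⟨c, hcn⟩) hc

/-- **Ex 6.3 (ii), negative square at a good place, with the element exported and its `Aut_±`-membership**
([IUTchI] Ex 6.3 (ii) p.161; sharpening of abc-iut-L5-t4's `exists_negCompat_good`, p422024): conditional on the typed §1 claims
`hA`, for every decomposition group `Gv` there is `c ∈ Π_{C̲_K} ∖ Π_{X̲_K}` normalising `Π_v̲ = Π_{X̲→_K} ∩ augGF⁻¹ Gv` and `Π_{X̲_K}`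
such that the local automorphism `a = (xΠ_v̲ ↦ xcΠ_v̲)` and the global `b = (xΠ_{X̲_K} ↦ xcΠ_{X̲_K})` satisfy
`a ≫ φ^{Θell}_{•,v̲} = φ^{Θell}_{•,v̲} ≫ b` (abc-iut-L5-t13 `OrbitCat.autOfNormalizer_comp_incl`, p421603) and `toFlStarGlobal b = 1`.
([IUTchI] Ex 6.3 (ii) p.161) [claim: Mochizuki2012, status: disputed] -/
theorem exists_negCompat_good_mem [Fact l.Prime] [(D.PiXund.subgroupOf D.PiXK).Normal]
    (hA : D.geom.pe.ArrowCoveringClaims) (Gv : Subgroup (Fbar ≃ₐ[F] Fbar)) :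
    ∃ (c : D.PiC), c ∈ D.PiCund ∧ c ∉ D.PiXund ∧
      ∃ (hcv : c ∈ Subgroup.normalizer ((D.PiXarrow ⊓ Gv.comap D.augGF : Subgroup D.PiC) : Set D.PiC))
        (hcK : c ∈ Subgroup.normalizer ((D.PiXund : Subgroup D.PiC) : Set D.PiC)),
      (OrbitCat.autOfNormalizer c hcv).hom ≫ D.phiEllAt Gv = D.phiEllAt Gv ≫ (OrbitCat.autOfNormalizer c hcK).hom ∧
      D.toFlStarGlobal (OrbitCat.autOfNormalizer c hcK) = 1 := by
  obtain ⟨-, c, hcv, ⟨hcCarrow, hcGv⟩, hcX, -, -⟩ := D.exists_localInvolution hA Gv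
  have hcCund : c ∈ D.PiCund := D.PiCarrow_le_PiCund hcCarrow
  have hcU : c ∉ D.PiXund := D.not_mem_PiXund_of_mem_PiCarrow hA hcCarrow (fun h => hcX ⟨h, hcGv⟩)
  have hcK : c ∈ Subgroup.normalizer ((D.PiXund : Subgroup D.PiC) : Set D.PiC) :=
    D.piCund_le_normalizer_piXund hcCund
  exact ⟨c, hcCund, hcU, hcv, hcK,
    OrbitCat.autOfNormalizer_comp_incl (D.sub_locModelObj_le_PiXund Gv) hcv hcK,
    D.toFlStarGlobal_autOfNormalizer_eq_one_of_mem_PiCund hcCund hcK⟩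

/-- **All (β)-inputs at a good place, pinned to ONE element, read on abc-iut-L5-t1's cusp interface** ([IUTchI] Ex 6.3 (ii)
p.161 with §1 p.37 and Def 6.1 (iii)/(v)): conditional on the typed §1 claims `hA`, for every decomposition group `Gv` there are
`c′ ∈ Π_{C̲} ∖ Π_X` (in `Π_{C_K}`, abc-iut-L5-t1's `PuncturedEllipticData` of the `K`-curve) and `c = embK c′ ∈ Π_{C̲_K} ∖ Π_{X̲_K}` with:
the square `a ≫ φ^{Θell}_{•,v̲} = φ^{Θell}_{•,v̲} ≫ b` for `a = (xΠ_v̲ ↦ xcΠ_v̲)`, `b = (xΠ_{X̲_K} ↦ xcΠ_{X̲_K})`; `toFlStarGlobal b = 1`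
(`b ∈ Aut_±(𝒟^{⊚±})`); and, for every cusp-action datum `CG`, `CG.act c′ ε⁰ = ε⁰` (the zero cusp is FIXED) and `CG.act c′ ε′ = ε″`
(a cusp is MOVED, `ε′ ≠ ε″`). ([IUTchI] Ex 6.3 (ii) p.161) [claim: Mochizuki2012, status: disputed] -/
theorem exists_negCompat_good_cusp [Fact l.Prime] [(D.PiXund.subgroupOf D.PiXK).Normal]
    (hA : D.geom.pe.ArrowCoveringClaims) (Gv : Subgroup (Fbar ≃ₐ[F] Fbar)) :
    ∃ (c' : D.geom.pe.PiC) (c : D.PiC), c' ∈ D.geom.pe.PiCbar ∧ c' ∉ D.geom.pe.PiX ∧ D.geom.embK c' = c ∧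
      c ∈ D.PiCund ∧ c ∉ D.PiXund ∧
      (∃ (hcv : c ∈ Subgroup.normalizer ((D.PiXarrow ⊓ Gv.comap D.augGF : Subgroup D.PiC) : Set D.PiC))
          (hcK : c ∈ Subgroup.normalizer ((D.PiXund : Subgroup D.PiC) : Set D.PiC)),
        (OrbitCat.autOfNormalizer c hcv).hom ≫ D.phiEllAt Gv = D.phiEllAt Gv ≫ (OrbitCat.autOfNormalizer c hcK).hom ∧
        D.toFlStarGlobal (OrbitCat.autOfNormalizer c hcK) = 1) ∧
      ∀ CG : D.geom.pe.CuspGalois,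
        CG.act c' D.geom.pe.ε0 = D.geom.pe.ε0 ∧ CG.act c' D.geom.pe.ε1 = D.geom.pe.ε2 ∧ D.geom.pe.ε1 ≠ D.geom.pe.ε2 := by
  obtain ⟨c, hcCund, hcU, hsq⟩ := D.exists_negCompat_good_mem hA Gv
  obtain ⟨c', hc', rfl⟩ := Subgroup.mem_map.mp hcCund
  have hc'X : c' ∉ D.geom.pe.PiX := by
    intro h
    apply hcU
    have hbar : c' ∈ D.geom.pe.PiXbar := by
      rw [PuncturedEllipticData.PiXbar, Subgroup.mem_inf]
      exact ⟨h, hc'⟩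
    exact Subgroup.mem_map.mpr ⟨c', hbar, rfl⟩
  exact ⟨c', _, hc', hc'X, rfl, hcCund, hcU, hsq, fun CG =>
    ⟨CG.act_ε0 c' hc', CG.act_ε1 c' hc' hc'X, D.geom.pe.ε1_ne_ε2⟩⟩

end InitialThetaData

end Genuine

end Literature.IUT.HodgeTheaters
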